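import Mathlib.Analysis.SpecialFunctions.Complex.Log
import Mathlib.Analysis.Complex.Basic
import Mathlib.Data.Fintype.Pi
import HarnessLib

/-!
# Named fact: the Lee–Yang circle theorem for finite spin-½ ferromagnets

Grounder file (D-0014 named facts) for the route `RiemannHypothesis/LeeYang`, statement item
stmt-RiemannHypothesis-0455 (`lee_yang_circle_theorem_finite`); first declaration of the requested
`Literature/Probability/LatticeModels/LeeYang.lean` (definition-demand `IsIsingLimitLaw` is NOT
attempted here).

Lee–Yang (Phys. Rev. 87 (1952) 410–419, Appendix II) in its multivariate form: for a finite set of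
`n` Ising spins `σᵢ = ±1` with pair couplings `Jᵢⱼ ≥ 0` (any non-negative matrix; diagonal terms
and the symmetric double count only add constants / rescale) and complex fields `hᵢ` all in the
open right half plane `Re hᵢ > 0` (fugacities `zᵢ = e^{−2hᵢ}` all inside the unit disc), the
partition function `Z = ∑_σ exp(∑ᵢⱼ Jᵢⱼ σᵢσⱼ + ∑ᵢ hᵢ σᵢ)` does not vanish. Asano (J. Phys.
Soc. Japan 29 (1970) 350; Phys. Rev. Lett. 24 (1970) 1409) gave the contraction proof;
Ruelle (2010 survey, §1) and Lieb–Sokal (1981) generalise. Here `σᵢσⱼ` is written as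
`if σ i = σ j then 1 else −1` on `σ : Fin n → Bool`.

Nothing is asserted; users take `(h : Literature.StatMech.lee_yang_circle_theorem_finite)`.

## References

* T. D. Lee, C. N. Yang, *Statistical theory of equations of state and phase transitions. II.
  Lattice gas and Ising model*, Phys. Rev. 87 (1952), 410–419, Appendix II.
* T. Asano, J. Phys. Soc. Japan 29 (1970), 350–359.
* D. Ruelle, *Characterization of Lee–Yang polynomials*, Ann. of Math. 171 (2010), §1.
-/

noncomputable section

open scoped BigOperators

namespace Literature.Probability.LatticeModels

/-- NAMED FACT (Lee–Yang circle theorem, multivariate finite form; Lee–Yang 1952 App. II;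
Asano 1970). For `n` spins, couplings `J i j ≥ 0` and complex fields with `0 < Re (h i)` for
every `i`, the Ising partition function
`∑_{σ : Fin n → Bool} exp (∑ᵢ ∑ⱼ Jᵢⱼ [σᵢ = σⱼ ? 1 : −1] + ∑ᵢ hᵢ [σᵢ ? 1 : −1])` is non-zero.
(Equivalently: all zeros in each `hᵢ`, the others fixed in the closed right half plane, are purely
imaginary — the "unit circle" in `zᵢ = e^{−2hᵢ}`.) Users take
`(h : lee_yang_circle_theorem_finite)`. [cite: LeeYang1952, Appendix II] -/
def lee_yang_circle_theorem_finite : Prop :=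
  ∀ (n : ℕ) (J : Fin n → Fin n → ℝ) (h : Fin n → ℂ), (∀ i j, 0 ≤ J i j) → (∀ i, 0 < (h i).re) →
    (∑ σ : Fin n → Bool, Complex.exp ((∑ i, ∑ j, ((J i j : ℂ) * (if σ i = σ j then 1 else -1))) +
      ∑ i, h i * (if σ i then 1 else -1))) ≠ 0

end Literature.Probability.LatticeModels

end
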